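import Summits.ValiantsHypothesis.ValiantsHypothesis.Theorems.DepthWindowNotHomAtBelowTwo
import HarnessLib
import HarnessLib.Audit

/-!
# DepthWindow — the homogenisation dial over an ARBITRARY field: `HomAtOver K`, `ImmHomAtOver K`,
the abstract endgame `ConstHomSquash K c₂ B k → False`, and the FLOOR
`p < q → ¬ ImmHomAtOver K p q c₀ a` (every field `K`)

Decomposition workshop decomp-valiant, lens 2 (gen 34), CALLED offer O-L2-8 (critic bus 943), STAGE 1.
`DepthWindowHomRel.HomAt p q c₀ a` is the uniform homogenisation dial over `ℂ` (product depth
`Δ ↦ ⌊pΔ/q⌋ + c₀`, size `(s+|σ|+2)^a·2^{a d²}`); `DepthWindowNotHomAtBelowTwo` refuted every slope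
`p/q < 2` over `ℂ` by iterating «homogenise, then halve by duality» — the halving is the only step
that uses `ℂ`.  THIS FILE drops it.  (1) `HomAtOver K p q c₀ a` is `HomAt` verbatim with `ℂ ↦ K`
(`homAt_iff_homAtOver_complex : Iff.rfl`); `ImmHomAtOver K p q c₀ a` is its restriction to the
targets `IMM_{n,d}` over `K`.  (2) ABSTRACT ENDGAME `constHomSquash_false`: no field `K` admits a map
sending every circuit for `IMM_{n,d}` of product depth `≤ e+1` and size `≤ X` (`X ≥ 2`,
`d n² + 2 ≤ X`, `2^{d²} ≤ X`) to an every-gate-homogeneous one of CONSTANT product depth `c₂ ≥ 1` and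
size `≤ X^{B(e+1)^k}` — start from divide and conquer (`exists_circuit_immPoly K`, any commutative
semiring), end with the homogeneous LST bound `homLst_geom_solved K` (any field), count as in
`not_homAt_of_lt_two_mul` (`λ = 2^v`, `e = v(2^{c₂}-1)+2^{c₂}`, `d = 2^e`, `n = 2^{20c₂L'}`,
`L' = 2^{2e}+e2^e+10d+1`, `v` with `42c₂B·M₂^{k+1}·v^{k+1} + 11 < 2^v`).  (3) THE FLOOR, for EVERY
field `K`: `p < q → ¬ ImmHomAtOver K p q c₀ a` (so `¬ HomAtOver K p q c₀ a`): a sub-unit slope is a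
contraction WITHOUT halving — the round `Δ ↦ ⌊pΔ/q⌋ + c₀` is dominated by the round
`(⌊2pΔ/q⌋ + 2c₀ + 1)/2` of `DepthWindowHomAtIterate.depthSeq (2p) q (2c₀)`, so `depthSeq_le_const` /
`sizeSeq_le_pow` (`2p < 2q`) give constant depth `4q²(2c₀+1)` after `2q(⌊log₂(e+1)⌋+1)` rounds at
size `X^{E^T}`, `E = 24(a+1)`; one more homogenisation supplies the squash (`c₂ = ⌊p·4q²(2c₀+1)/q⌋ +
c₀ + 1`, `k = (⌊log₂E⌋+1)·2q`, `B = 3a·2^k`).  Calibration over `ℂ`: `[0,2)` is refuted there for ALL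
targets (`not_homAtOver_complex` = `not_homAt_of_lt_two_mul`); a single sub-unit-slope homogenisation
at the `L₃` scale contradicts nothing — only the UNIFORM statement iterated from depth `log₂ d` does.
Census (v28, on landing): W12-any-field «hom dial ∀K: [0,1) FALSE·KERNEL; ℂ: [0,2) FALSE·KERNEL»;
the door (`ImmHomAtOver K` at slope `≤ 36/25·q′/p′` ⟹ `IMM` hardness at slope `p′/q′` over `K`) is
STAGE 2.  Nothing here is `S`-currency; rung 0; `VP ≠ VNP` untouched; no route items.
References: LimayeSrinivasanTavenas2025 (Lemma 11, Cor. 4); Forbes2024LowDepth (Thm. 1);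
BhargavDuttaSaxena2024 (Thm. 1.4).
-/

noncomputable section

open MvPolynomial

-- the summit and the problem share the name `ValiantsHypothesis` (D-0017 single-conjunct layout)
set_option linter.dupNamespace false

namespace Summit.ValiantsHypothesis.ValiantsHypothesis.Theorems.DepthWindowHomContraction

open Literature.Computability.AlgebraicComplexity ArithCircuit
open Summit.ValiantsHypothesis.ValiantsHypothesis.Theorems.DepthWindow
open Summit.ValiantsHypothesis.ValiantsHypothesis.Theorems.DepthWindowHomAtIterate
open Summit.ValiantsHypothesis.ValiantsHypothesis.Theorems.DepthWindowImmDivideConquer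
open Summit.ValiantsHypothesis.ValiantsHypothesis.Theorems.DepthWindowNotHomAtBelowTwo

/-! ### The dial over a field `K` -/

/-- **Homogenisation at slope `p/q` with constants `c₀, a` over the field `K`**: `HomAt p q c₀ a`
of `DepthWindowHomRel` verbatim with `ℂ ↦ K` — every product-depth-`Δ`, size-`s` circuit over `K`
computing a degree-`d` homogeneous `f` over `σ` has an every-gate-homogeneous circuit computing `f`
of product depth `≤ ⌊pΔ/q⌋ + c₀` and size `≤ (s + |σ| + 2)^a · 2^{a d²}`.
[cite: LimayeSrinivasanTavenas2025, Lemma 11] [cite: Forbes2024LowDepth, Thm. 1] -/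
def HomAtOver (K : Type) [Field K] (p q c₀ a : ℕ) : Prop :=
  ∀ (σ : Type) [Fintype σ] (d : ℕ) (f : MvPolynomial σ K), f.IsHomogeneous d →
    ∀ D : ArithCircuit K σ, D.Computes f → ∃ D' : ArithCircuit K σ,
      D'.Computes f ∧ (∀ g ∈ ArithCircuit.gateValues D'.gates, ∃ e : ℕ, g.IsHomogeneous e) ∧
      D'.productDepth ≤ p * D.productDepth / q + c₀ ∧
      D'.size ≤ (D.size + Fintype.card σ + 2) ^ a * 2 ^ (a * d * d)

/-- Calibration: the `ℂ`-dial `HomAt` IS `HomAtOver ℂ`. [cite: LimayeSrinivasanTavenas2025, Lemma 11] -/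
theorem homAt_iff_homAtOver_complex (p q c₀ a : ℕ) : HomAt p q c₀ a ↔ HomAtOver ℂ p q c₀ a :=
  Iff.rfl

/-- **The dial restricted to `IMM`**: homogenisation at slope `p/q`, constants `c₀, a`, of circuits
over `K` computing `IMM_{n,d}` (variables `Fin d × Fin n × Fin n`, `|σ| = d n²`).
[cite: LimayeSrinivasanTavenas2025, Lemma 11, Cor. 4] -/
def ImmHomAtOver (K : Type) [Field K] (p q c₀ a : ℕ) : Prop :=
  ∀ (n d : ℕ) (D : ArithCircuit K (Fin d × Fin n × Fin n)), D.Computes (immPoly n d K) →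
    ∃ D' : ArithCircuit K (Fin d × Fin n × Fin n), D'.Computes (immPoly n d K) ∧
      (∀ g ∈ ArithCircuit.gateValues D'.gates, ∃ e : ℕ, g.IsHomogeneous e) ∧
      D'.productDepth ≤ p * D.productDepth / q + c₀ ∧
      D'.size ≤ (D.size + d * (n * n) + 2) ^ a * 2 ^ (a * d * d)

/-- The uniform dial implies its `IMM` restriction. [cite: LimayeSrinivasanTavenas2025, Lemma 11] -/
theorem immHomAtOver_of_homAtOver (K : Type) [Field K] {p q c₀ a : ℕ} (h : HomAtOver K p q c₀ a) :
    ImmHomAtOver K p q c₀ a := by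
  intro n d D hD
  have hcard : Fintype.card (Fin d × Fin n × Fin n) = d * (n * n) := by
    simp [Fintype.card_prod, Fintype.card_fin]
  obtain ⟨D', h1, h2, h3, h4⟩ := h _ d _ (immPoly_isHomogeneous_holds (k := K) n d) D hD
  rw [hcard] at h4
  exact ⟨D', h1, h2, h3, h4⟩

/-! ### The contraction: `t` rounds of «homogenise» alone, dominated by `depthSeq (2p) q (2c₀)` -/

/-- Product depth after `t` plain rounds: `Δ₀`, then `Δ ↦ ⌊pΔ/q⌋ + c₀`.
[cite: LimayeSrinivasanTavenas2025, Lemma 11] -/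
def hdepth (p q c₀ Δ₀ : ℕ) : ℕ → ℕ
  | 0 => Δ₀
  | t + 1 => p * hdepth p q c₀ Δ₀ t / q + c₀

/-- Size after `t` plain rounds: `s₀`, then `s ↦ (s+N+2)^a·2^{a d²}`.
[cite: LimayeSrinivasanTavenas2025, Lemma 11] -/
def hsize (a N d s₀ : ℕ) : ℕ → ℕ
  | 0 => s₀
  | t + 1 => (hsize a N d s₀ t + N + 2) ^ a * 2 ^ (a * d * d)

/-- The plain round is dominated by the «homogenise at `(2p, q, 2c₀)`, then halve» round:
`hdepth p q c₀ Δ₀ t ≤ depthSeq (2p) q (2c₀) Δ₀ t`. [cite: LimayeSrinivasanTavenas2025, Lemma 11] -/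
theorem hdepth_le_depthSeq (p q c₀ Δ₀ t : ℕ) :
    hdepth p q c₀ Δ₀ t ≤ depthSeq (2 * p) q (2 * c₀) Δ₀ t := by
  induction t with
  | zero => exact le_rfl
  | succ t ih =>
    show p * hdepth p q c₀ Δ₀ t / q + c₀ ≤
      (2 * p * depthSeq (2 * p) q (2 * c₀) Δ₀ t / q + 2 * c₀ + 1) / 2
    set x := hdepth p q c₀ Δ₀ t
    set y := depthSeq (2 * p) q (2 * c₀) Δ₀ t
    have h1 : p * x / q ≤ p * y / q := Nat.div_le_div_right (Nat.mul_le_mul_left p ih)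
    have h2 : 2 * (p * y / q) ≤ 2 * p * y / q := by
      rw [mul_assoc]; exact Nat.mul_div_le_mul_div_assoc _ _ _
    omega

/-- `hsize ≤ sizeSeq` (the extra halving cost only enlarges). [cite: LimayeSrinivasanTavenas2025, Lemma 11] -/
theorem hsize_le_sizeSeq (a N d s₀ t : ℕ) : hsize a N d s₀ t ≤ sizeSeq a N d s₀ t := by
  induction t with
  | zero => exact le_rfl
  | succ t ih =>
    show (hsize a N d s₀ t + N + 2) ^ a * 2 ^ (a * d * d) ≤
      ((sizeSeq a N d s₀ t + N + 2) ^ a * 2 ^ (a * d * d) + N + 2) ^ 8 * 2 ^ (8 * d)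
    set z := (sizeSeq a N d s₀ t + N + 2) ^ a * 2 ^ (a * d * d)
    have h1 : (hsize a N d s₀ t + N + 2) ^ a * 2 ^ (a * d * d) ≤ z :=
      Nat.mul_le_mul_right _ (Nat.pow_le_pow_left (by omega) a)
    have h2 : z ≤ (z + N + 2) ^ 8 :=
      calc z ≤ z + N + 2 := by omega
        _ = (z + N + 2) ^ 1 := (pow_one _).symm
        _ ≤ (z + N + 2) ^ 8 := Nat.pow_le_pow_right (by omega) (by norm_num)
    calc (hsize a N d s₀ t + N + 2) ^ a * 2 ^ (a * d * d) ≤ z := h1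
      _ ≤ (z + N + 2) ^ 8 * 1 := by rw [mul_one]; exact h2
      _ ≤ (z + N + 2) ^ 8 * 2 ^ (8 * d) := Nat.mul_le_mul_left _ Nat.one_le_two_pow

/-- **`t` plain rounds exist** under `ImmHomAtOver K p q c₀ a`.
[cite: LimayeSrinivasanTavenas2025, Lemma 11] -/
theorem imm_iterate (K : Type) [Field K] {p q c₀ a : ℕ} (hH : ImmHomAtOver K p q c₀ a) {n d : ℕ}
    {D : ArithCircuit K (Fin d × Fin n × Fin n)} (hD : D.Computes (immPoly n d K)) (t : ℕ) :
    ∃ D' : ArithCircuit K (Fin d × Fin n × Fin n), D'.Computes (immPoly n d K) ∧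
      D'.productDepth ≤ hdepth p q c₀ D.productDepth t ∧
      D'.size ≤ hsize a (d * (n * n)) d D.size t := by
  induction t with
  | zero => exact ⟨D, hD, le_rfl, le_rfl⟩
  | succ t ih =>
    obtain ⟨D₁, hD₁, hD₁d, hD₁s⟩ := ih
    obtain ⟨D₂, hD₂, -, hD₂d, hD₂s⟩ := hH n d D₁ hD₁
    refine ⟨D₂, hD₂, hD₂d.trans ?_, hD₂s.trans ?_⟩
    · show p * D₁.productDepth / q + c₀ ≤ p * hdepth p q c₀ D.productDepth t / q + c₀
      exact Nat.add_le_add_right (Nat.div_le_div_right (Nat.mul_le_mul_left p hD₁d)) c₀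
    · show (D₁.size + d * (n * n) + 2) ^ a * 2 ^ (a * d * d) ≤
        (hsize a (d * (n * n)) d D.size t + d * (n * n) + 2) ^ a * 2 ^ (a * d * d)
      exact Nat.mul_le_mul_right _ (Nat.pow_le_pow_left (by omega) a)

/-- **`T = 2q(⌊log₂Δ₀⌋+1)` plain rounds reach constant depth** `4q·q(2c₀+1)` at size
`≤ X^{(24(a+1))^T}` when `p < q` (ceiling `X ≥ 2`, `d n² + 2 ≤ X`, `2^{d²} ≤ X`, `D.size ≤ X`).
[cite: LimayeSrinivasanTavenas2025, Lemma 11] -/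
theorem imm_iterate_to_const (K : Type) [Field K] {p q c₀ a : ℕ} (hp : p < q)
    (hH : ImmHomAtOver K p q c₀ a) {n d : ℕ} {D : ArithCircuit K (Fin d × Fin n × Fin n)}
    (hD : D.Computes (immPoly n d K)) {X Δ₀ : ℕ} (hX : 2 ≤ X) (hN : d * (n * n) + 2 ≤ X)
    (hdX : 2 ^ (d * d) ≤ X) (hs : D.size ≤ X) (hΔ : D.productDepth ≤ Δ₀) :
    ∃ D' : ArithCircuit K (Fin d × Fin n × Fin n), D'.Computes (immPoly n d K) ∧
      D'.productDepth ≤ 4 * q * (q * (2 * c₀ + 1)) ∧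
      D'.size ≤ X ^ ((24 * (a + 1)) ^ (2 * q * (Nat.log 2 Δ₀ + 1))) := by
  have hp2 : 2 * p < 2 * q := by omega
  obtain ⟨D', hD', hD'd, hD's⟩ := imm_iterate K hH hD (2 * q * (Nat.log 2 Δ₀ + 1))
  refine ⟨D', hD', ?_, ?_⟩
  · exact hD'd.trans ((hdepth_le_depthSeq p q c₀ _ _).trans
      ((depthSeq_mono (p := 2 * p) (q := q) (c₀ := 2 * c₀) hΔ _).trans
        (depthSeq_le_const hp2 Δ₀)))
  · exact hD's.trans ((hsize_le_sizeSeq a _ d _ _).trans (sizeSeq_le_pow hX hN hdX hs _))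

/-! ### The abstract endgame over `K` -/

/-- **Constant-depth homogeneous squash** (the endgame hypothesis): every circuit over `K` for
`IMM_{n,d}` of product depth `≤ e+1` and size `≤ X` (`X ≥ 2`, `d n² + 2 ≤ X`, `2^{d²} ≤ X`) has an
every-gate-homogeneous one of product depth `≤ c₂` and size `≤ X^{B(e+1)^k}`.
[cite: LimayeSrinivasanTavenas2025, Lemma 11, Cor. 4] -/
def ConstHomSquash (K : Type) [Field K] (c₂ B k : ℕ) : Prop :=
  ∀ (n d e X : ℕ) (D : ArithCircuit K (Fin d × Fin n × Fin n)), 2 ≤ X → d * (n * n) + 2 ≤ X →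
    2 ^ (d * d) ≤ X → D.Computes (immPoly n d K) → D.productDepth ≤ e + 1 → D.size ≤ X →
    ∃ D' : ArithCircuit K (Fin d × Fin n × Fin n), D'.Computes (immPoly n d K) ∧
      (∀ g ∈ ArithCircuit.gateValues D'.gates, ∃ i : ℕ, g.IsHomogeneous i) ∧
      D'.productDepth ≤ c₂ ∧ D'.size ≤ X ^ (B * (e + 1) ^ k)

/-- **The abstract endgame: no field admits a constant-depth homogeneous squash** (`c₂ ≥ 1`).
Divide and conquer for `IMM_{n,2^e}` (depth `e+1`, size `≤ (2n²+n+2)^{e+1} ≤ X₀ = 2^{(2L+2)(e+1)}`),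
squash, and compare with the homogeneous LST bound `2^{⌊log₂ n⌋(λ-10)/(20c₂)} ≤ s·d^d + 1`
(`λ = 2^v`, `λ^{2^{c₂}-1}·2^{2^{c₂}} ≤ d`, `10d ≤ ⌊log₂ n⌋`): with `e = v(2^{c₂}-1)+2^{c₂}`, `d = 2^e`,
`L' = 2^{2e}+e2^e+10d+1`, `L = 20c₂L'`, `n = 2^L` the comparison reads
`L'(2^v-10) ≤ (2L+2)(e+1)·B(e+1)^k + e2^e + 1 ≤ L'(42c₂B·M₂^{k+1}v^{k+1} + 1)`, refuted by the choice
`42c₂B·M₂^{k+1}·v^{k+1} + 11 < 2^v`. [cite: LimayeSrinivasanTavenas2025, Lemma 11, Cor. 4]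
[cite: Forbes2024LowDepth, Thm. 1] -/
theorem constHomSquash_false (K : Type) [Field K] {c₂ B k : ℕ} (hc₂1 : 1 ≤ c₂)
    (hS : ConstHomSquash K c₂ B k) : False := by
  obtain ⟨M, hM⟩ : ∃ M, M = 2 ^ c₂ - 1 := ⟨_, rfl⟩
  obtain ⟨M₂, hM₂⟩ : ∃ M₂, M₂ = M + 2 ^ c₂ + 1 := ⟨_, rfl⟩
  -- the free parameter `v` (`λ = 2^v`)
  obtain ⟨v, hv4, hv⟩ := exists_lt_two_pow (42 * c₂ * B * M₂ ^ (k + 1)) (k + 1)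
  have hv16 : 16 ≤ 2 ^ v := by
    calc (16 : ℕ) = 2 ^ 4 := by norm_num
      _ ≤ 2 ^ v := Nat.pow_le_pow_right (by norm_num) hv4
  obtain ⟨e, he⟩ : ∃ e, e = v * M + 2 ^ c₂ := ⟨_, rfl⟩
  obtain ⟨d, hd⟩ : ∃ d, d = 2 ^ e := ⟨_, rfl⟩
  have hd1 : 1 ≤ d := by rw [hd]; exact Nat.one_le_two_pow
  obtain ⟨L', hL'⟩ : ∃ L', L' = 2 ^ (2 * e) + e * 2 ^ e + 10 * d + 1 := ⟨_, rfl⟩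
  have hL'1 : 1 ≤ L' := by rw [hL']; exact Nat.le_add_left 1 _
  obtain ⟨L, hL⟩ : ∃ L, L = 20 * c₂ * L' := ⟨_, rfl⟩
  have hL'L : L' ≤ L := by
    rw [hL]
    have := Nat.mul_le_mul_right L' (show 1 ≤ 20 * c₂ by omega)
    simpa using this
  have hL1 : 1 ≤ L := hL'1.trans hL'L
  obtain ⟨n, hn⟩ : ∃ n, n = 2 ^ L := ⟨_, rfl⟩
  have hlog : Nat.log 2 n = L := by rw [hn]; exact Nat.log_pow (by norm_num) _
  have hn2 : 2 ≤ n := by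
    rw [hn]
    calc (2 : ℕ) = 2 ^ 1 := by norm_num
      _ ≤ 2 ^ L := Nat.pow_le_pow_right (by norm_num) hL1
  -- the start circuit: divide and conquer for `IMM_{n,d}`, depth `e+1`, size `≤ (2n²+n+2)^{e+1}`
  obtain ⟨C₀, hC₀, hC₀d, hC₀s⟩ := exists_circuit_immPoly K n (d := d) (e := e) hd1 (by rw [hd])
  -- the common ceiling `X₀ = 2^{(2L+2)(e+1)}`
  obtain ⟨X₀, hX₀⟩ : ∃ X₀, X₀ = 2 ^ ((2 * L + 2) * (e + 1)) := ⟨_, rfl⟩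
  have hexp1 : 1 ≤ (2 * L + 2) * (e + 1) :=
    le_trans (by norm_num) (Nat.mul_le_mul (show 1 ≤ 2 * L + 2 by omega) (show 1 ≤ e + 1 by omega))
  have hX₀2 : 2 ≤ X₀ := by
    rw [hX₀]
    calc (2 : ℕ) = 2 ^ 1 := by norm_num
      _ ≤ 2 ^ ((2 * L + 2) * (e + 1)) := Nat.pow_le_pow_right (by norm_num) hexp1
  have hLe : L ≤ (2 * L + 2) * (e + 1) :=
    calc L ≤ 2 * L + 2 := by omega
      _ ≤ (2 * L + 2) * (e + 1) := Nat.le_mul_of_pos_right _ (by omega)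
  have hLe' : e + 2 * L + 1 ≤ (2 * L + 2) * (e + 1) := by
    have h := Nat.le_mul_of_pos_left e (show 0 < 2 * L + 2 by omega)
    calc e + 2 * L + 1 ≤ (2 * L + 2) * e + (2 * L + 2) := by omega
      _ = (2 * L + 2) * (e + 1) := by ring
  have hN : d * (n * n) + 2 ≤ X₀ := by
    rw [hX₀, hd, hn]
    have h1 : 2 ^ e * (2 ^ L * 2 ^ L) = 2 ^ (e + 2 * L) := by rw [two_mul, pow_add, pow_add]
    have h2 : 2 ^ (e + 2 * L) + 2 ≤ 2 ^ (e + 2 * L + 1) := by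
      have : 2 ≤ 2 ^ (e + 2 * L) := by
        calc (2 : ℕ) = 2 ^ 1 := by norm_num
          _ ≤ 2 ^ (e + 2 * L) := Nat.pow_le_pow_right (by norm_num) (by omega)
      calc 2 ^ (e + 2 * L) + 2 ≤ 2 ^ (e + 2 * L) + 2 ^ (e + 2 * L) := Nat.add_le_add_left this _
        _ = 2 ^ (e + 2 * L + 1) := by ring
    have h3 : 2 ^ (e + 2 * L + 1) ≤ 2 ^ ((2 * L + 2) * (e + 1)) :=
      Nat.pow_le_pow_right (by norm_num) hLe'
    rw [h1]; exact h2.trans h3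
  have hdX : 2 ^ (d * d) ≤ X₀ := by
    rw [hX₀, hd]
    apply Nat.pow_le_pow_right (by norm_num)
    have h1 : 2 ^ e * 2 ^ e = 2 ^ (2 * e) := by rw [two_mul, pow_add]
    have h2 : 2 ^ (2 * e) ≤ L' := by
      rw [hL']; exact le_add_right (le_add_right (Nat.le_add_right _ _))
    rw [h1]; exact h2.trans (hL'L.trans hLe)
  have hs : C₀.size ≤ X₀ := by
    rw [hX₀]
    refine hC₀s.trans ?_
    rw [pow_mul 2 (2 * L + 2) (e + 1)]
    apply Nat.pow_le_pow_left
    have h4 : 2 ^ (2 * L + 2) = 4 * (n * n) := by rw [hn]; ring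
    have h5 : n * 2 ≤ n * n := Nat.mul_le_mul_left n hn2
    rw [h4, Nat.mul_assoc]; omega
  -- squash: every gate homogeneous, depth `≤ c₂`, size `≤ X₀^{B(e+1)^k} = 2^A`
  obtain ⟨D₂, hD₂, hD₂hom, hD₂c₂, hD₂s⟩ := hS n d e X₀ C₀ hX₀2 hN hdX hC₀ hC₀d hs
  -- the homogeneous LST bound at `Δ = c₂`, `λ = 2^v`
  have hlam : (1 : ℝ) ≤ (2 : ℝ) ^ v := by exact_mod_cast Nat.one_le_two_pow
  have hfit : ((2 : ℝ) ^ v) ^ (2 ^ c₂ - 1) * 2 ^ (2 ^ c₂) ≤ (d : ℝ) := by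
    rw [hd, he, hM, ← pow_mul, ← pow_add]; exact_mod_cast le_rfl
  have hdn : 10 * d ≤ Nat.log 2 n := by
    rw [hlog]; exact le_trans (by rw [hL']; exact le_add_right (Nat.le_add_left _ _)) hL'L
  have hlst := homLst_geom_solved K hc₂1 n d hd1 hlam hfit hdn D₂ hD₂c₂ hD₂hom hD₂
  rw [hlog, hL] at hlst
  have hv10 : 10 ≤ 2 ^ v := le_trans (by norm_num) hv16
  have hexp : ((20 * c₂ * L' : ℕ) : ℝ) * ((2 : ℝ) ^ v - 10) / (20 * (c₂ : ℝ)) =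
      ((L' * (2 ^ v - 10) : ℕ) : ℝ) := by
    have hc : (20 * (c₂ : ℝ)) ≠ 0 := by
      have : (c₂ : ℝ) ≠ 0 := by exact_mod_cast (show c₂ ≠ 0 by omega)
      exact mul_ne_zero (by norm_num) this
    rw [div_eq_iff hc]
    push_cast [Nat.cast_sub hv10]
    ring
  rw [hexp, Real.rpow_natCast] at hlst
  have hnat : 2 ^ (L' * (2 ^ v - 10)) ≤ D₂.size * d ^ d + 1 := by exact_mod_cast hlst
  -- the upper bound `s·d^d + 1 ≤ 2^{A + e2^e + 1}`, `A = (2L+2)(e+1)·B(e+1)^k`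
  have hdd : d ^ d = 2 ^ (e * 2 ^ e) := by rw [hd, ← pow_mul]
  obtain ⟨A, hA⟩ : ∃ A, A = (2 * L + 2) * (e + 1) * (B * (e + 1) ^ k) := ⟨_, rfl⟩
  have hYA : X₀ ^ (B * (e + 1) ^ k) = 2 ^ A := by rw [hX₀, ← pow_mul, hA]
  have hSA : D₂.size ≤ 2 ^ A := hD₂s.trans (le_of_eq hYA)
  have hup : D₂.size * d ^ d + 1 ≤ 2 ^ (A + e * 2 ^ e + 1) := by
    rw [hdd]
    have h1 : D₂.size * 2 ^ (e * 2 ^ e) ≤ 2 ^ (A + e * 2 ^ e) := by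
      rw [pow_add]; exact Nat.mul_le_mul_right _ hSA
    have h2 : 1 ≤ 2 ^ (A + e * 2 ^ e) := Nat.one_le_two_pow
    calc D₂.size * 2 ^ (e * 2 ^ e) + 1 ≤ 2 ^ (A + e * 2 ^ e) + 2 ^ (A + e * 2 ^ e) :=
          Nat.add_le_add h1 h2
      _ = 2 ^ (A + e * 2 ^ e + 1) := by ring
  have hle : L' * (2 ^ v - 10) ≤ A + e * 2 ^ e + 1 := by
    by_contra hlt
    have h7 : 2 ^ (A + e * 2 ^ e + 1) < 2 ^ (L' * (2 ^ v - 10)) :=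
      Nat.pow_lt_pow_right (by norm_num) (not_le.mp hlt)
    exact absurd (hnat.trans hup) (not_le.mpr h7)
  -- the final count: `A + e2^e + 2 ≤ L'(42c₂B·M₂^{k+1}v^{k+1} + 1) ≤ L'(2^v - 10)`
  have heM : e + 1 ≤ v * M₂ := by
    have h1 : 2 ^ c₂ ≤ v * 2 ^ c₂ := Nat.le_mul_of_pos_left _ (by omega)
    have h2 : 1 ≤ v := by omega
    calc e + 1 = v * M + 2 ^ c₂ + 1 := by rw [he]
      _ ≤ v * M + v * 2 ^ c₂ + v := Nat.add_le_add (Nat.add_le_add_left h1 _) h2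
      _ = v * M₂ := by rw [hM₂]; ring
  have hpow : (e + 1) ^ (k + 1) ≤ M₂ ^ (k + 1) * v ^ (k + 1) :=
    calc (e + 1) ^ (k + 1) ≤ (v * M₂) ^ (k + 1) := Nat.pow_le_pow_left heM _
      _ = M₂ ^ (k + 1) * v ^ (k + 1) := by rw [mul_pow, mul_comm]
  have hA_le : A ≤ L' * (42 * c₂ * B * M₂ ^ (k + 1) * v ^ (k + 1)) := by
    rw [hA, hL]
    have hcl : 1 ≤ c₂ * L' := by simpa using Nat.mul_le_mul hc₂1 hL'1
    have h1 : 2 * (20 * c₂ * L') + 2 ≤ 42 * (c₂ * L') := by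
      rw [show 2 * (20 * c₂ * L') + 2 = 40 * (c₂ * L') + 2 by ring]; omega
    calc (2 * (20 * c₂ * L') + 2) * (e + 1) * (B * (e + 1) ^ k)
        = (2 * (20 * c₂ * L') + 2) * (B * (e + 1) ^ (k + 1)) := by ring
      _ ≤ 42 * (c₂ * L') * (B * (M₂ ^ (k + 1) * v ^ (k + 1))) :=
          Nat.mul_le_mul h1 (Nat.mul_le_mul_left B hpow)
      _ = L' * (42 * c₂ * B * M₂ ^ (k + 1) * v ^ (k + 1)) := by ring
  have hL'2 : e * 2 ^ e + 2 ≤ L' := by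
    have h22 : 1 ≤ 2 ^ (2 * e) := Nat.one_le_two_pow
    rw [hL']; omega
  have hG1 : 42 * c₂ * B * M₂ ^ (k + 1) * v ^ (k + 1) + 1 ≤ 2 ^ v - 10 := by omega
  have hfin : A + e * 2 ^ e + 2 ≤ L' * (2 ^ v - 10) :=
    calc A + e * 2 ^ e + 2 ≤ L' * (42 * c₂ * B * M₂ ^ (k + 1) * v ^ (k + 1)) + L' := by omega
      _ = L' * (42 * c₂ * B * M₂ ^ (k + 1) * v ^ (k + 1) + 1) := by ring
      _ ≤ L' * (2 ^ v - 10) := Nat.mul_le_mul_left L' hG1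
  omega

/-! ### The floor: no sub-unit slope over any field -/

/-- **A sub-unit slope squashes**: `ImmHomAtOver K p q c₀ a` with `p < q` yields a constant-depth
homogeneous squash with `c₂ = ⌊p·4q²(2c₀+1)/q⌋ + c₀ + 1`, `k = (⌊log₂(24(a+1))⌋+1)·2q`,
`B = 3a·2^k` (`2q(⌊log₂(e+1)⌋+1)` plain rounds, then one more homogenisation).
[cite: LimayeSrinivasanTavenas2025, Lemma 11, Cor. 4] -/
theorem exists_constHomSquash_of_immHomAtOver (K : Type) [Field K] {p q c₀ a : ℕ} (hp : p < q)
    (hH : ImmHomAtOver K p q c₀ a) : ∃ c₂ B k : ℕ, 1 ≤ c₂ ∧ ConstHomSquash K c₂ B k := by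
  obtain ⟨c₁, hc₁⟩ : ∃ c₁, c₁ = 4 * q * (q * (2 * c₀ + 1)) := ⟨_, rfl⟩
  obtain ⟨E, hE⟩ : ∃ E, E = 24 * (a + 1) := ⟨_, rfl⟩
  obtain ⟨k, hk⟩ : ∃ k, k = (Nat.log 2 E + 1) * (2 * q) := ⟨_, rfl⟩
  refine ⟨p * c₁ / q + c₀ + 1, 3 * a * 2 ^ k, k, Nat.le_add_left 1 _, ?_⟩
  intro n d e X D hX hN hdX hD hDd hDs
  -- `T` plain rounds: constant depth `c₁`, size `≤ X^{E^T}`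
  obtain ⟨D₁, hD₁, hD₁d, hD₁s⟩ := imm_iterate_to_const K hp hH hD hX hN hdX hDs hDd
  have hD₁c₁ : D₁.productDepth ≤ c₁ := by rw [hc₁]; exact hD₁d
  obtain ⟨T, hTdef⟩ : ∃ T, T = 2 * q * (Nat.log 2 (e + 1) + 1) := ⟨_, rfl⟩
  obtain ⟨Y, hY⟩ : ∃ Y, Y = X ^ (E ^ T) := ⟨_, rfl⟩
  have hD₁Y : D₁.size ≤ Y := by rw [hY, hE, hTdef]; exact hD₁s
  have hXY : X ≤ Y := by
    rw [hY]
    calc X = X ^ 1 := (pow_one _).symm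
      _ ≤ X ^ (E ^ T) := Nat.pow_le_pow_right (by omega) (Nat.one_le_pow _ _ (by omega))
  -- one more homogenisation: every gate homogeneous, depth `≤ c₂`, size `≤ Y^{3a}`
  obtain ⟨D₂, hD₂, hD₂hom, hD₂d, hD₂s⟩ := hH n d D₁ hD₁
  refine ⟨D₂, hD₂, hD₂hom, ?_, ?_⟩
  · refine hD₂d.trans ?_
    have h6 : p * D₁.productDepth / q ≤ p * c₁ / q :=
      Nat.div_le_div_right (Nat.mul_le_mul_left p hD₁c₁)
    exact (Nat.add_le_add_right h6 c₀).trans (Nat.le_succ _)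
  · have hS : D₂.size ≤ Y ^ (3 * a) :=
      hD₂s.trans (hom_cost_le (hX.trans hXY) (hN.trans hXY) (hdX.trans hXY) hD₁Y)
    have hET : E ^ T ≤ 2 ^ k * (e + 1) ^ k := by
      rw [hTdef, hk, mul_comm (2 * q) _, pow_mul E (Nat.log 2 (e + 1) + 1) (2 * q),
        ← mul_pow, pow_mul (2 * (e + 1)) (Nat.log 2 E + 1) (2 * q)]
      exact Nat.pow_le_pow_left (pow_log_succ_le E e) _
    refine hS.trans ?_
    rw [hY, ← pow_mul]
    apply Nat.pow_le_pow_right (by omega)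
    calc E ^ T * (3 * a) ≤ 2 ^ k * (e + 1) ^ k * (3 * a) := Nat.mul_le_mul_right _ hET
      _ = 3 * a * 2 ^ k * (e + 1) ^ k := by ring

/-- **THE FLOOR.  No `IMM`-homogenisation of sub-unit slope over any field**:
`p < q → ¬ ImmHomAtOver K p q c₀ a`. [cite: LimayeSrinivasanTavenas2025, Lemma 11, Cor. 4]
[cite: Forbes2024LowDepth, Thm. 1] -/
theorem not_immHomAtOver_of_lt (K : Type) [Field K] {p q c₀ a : ℕ} (hp : p < q) :
    ¬ ImmHomAtOver K p q c₀ a := by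
  intro hH
  obtain ⟨c₂, B, k, hc₂, hS⟩ := exists_constHomSquash_of_immHomAtOver K hp hH
  exact constHomSquash_false K hc₂ hS

/-- **No uniform homogenisation of sub-unit slope over any field.** [cite: LimayeSrinivasanTavenas2025, Lemma 11] -/
theorem not_homAtOver_of_lt (K : Type) [Field K] {p q c₀ a : ℕ} (hp : p < q) :
    ¬ HomAtOver K p q c₀ a :=
  fun h => not_immHomAtOver_of_lt K hp (immHomAtOver_of_homAtOver K h)

/-- **Calibration over `ℂ`** (all targets, slope `< 2`): `p < 2q → ¬ HomAtOver ℂ p q c₀ a` — this is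
`DepthWindowNotHomAtBelowTwo.not_homAt_of_lt_two_mul` read through `homAt_iff_homAtOver_complex`;
in particular `¬ ImmHomAtOver`-type conclusions below slope `2` over `ℂ` need the duality halving,
which this file does not use. [cite: LimayeSrinivasanTavenas2025, Lemma 11, Cor. 4] -/
theorem not_homAtOver_complex {p q c₀ a : ℕ} (hp : p < 2 * q) : ¬ HomAtOver ℂ p q c₀ a :=
  fun h => not_homAt_of_lt_two_mul hp ((homAt_iff_homAtOver_complex p q c₀ a).2 h)

end Summit.ValiantsHypothesis.ValiantsHypothesis.Theorems.DepthWindowHomContraction
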